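import Summits.QuantumAdvantage.QuantumAdvantage.Theorems.CharDialNearReadSubcubeA

/-! # CharDialNearReadSubcube — part 2/2 (mechanical split for landing of `CharDialNearReadSubcube`; content verbatim; scopes re-opened with their variables) -/


namespace Summit.QuantumAdvantage.AdviceFreeQNC0
open Finset AffBells22

namespace JLinPeel
open CounterLaw

section Near
variable {p n : ℕ} (A : Fin (n + 1) → ZMod p → Bool) (B : Fin (n + 1) → Fin n → ZMod p → Bool)
  (rp : Fin (n + 1) → Option (Fin n)) (φ : Fin (n + 1) → (Fin n → Bool) → ZMod p)
  (W : Finset (Fin n)) (b : Fin n → Bool)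

variable (hφ : ∀ g : Fin (n + 1), ∀ u v : Fin n → Bool, wtPrefix u g.val % p = wtPrefix v g.val % p → φ g u = φ g v)
  (hseg : ∀ g t, rp g = some t → t ∉ W → ∀ i ∈ seg g t, i ∈ W)
include hφ hseg

/-- **the fibration**: the winning free-read cuts, counted by read position, are the re-timed counts `crdN`. -/
theorem card_yF_eq_sum (u : Fin n → Bool) (s : ZMod 3) :
    (univ.filter fun g : Fin (n + 1) =>
        yF B rp φ W g (subcubeMerge W b u) = true ∧ labN (subcubeMerge W b u) g.val ≠ s).card
      = ∑ i ∈ range n, crdN B rp φ W b (subcubeMerge W b u) i s := by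
  classical
  set u' := subcubeMerge W b u with hu'
  set S := univ.filter fun g : Fin (n + 1) => yF B rp φ W g u' = true ∧ labN u' g.val ≠ s with hS
  -- members of `S` read a free position carrying a `1`
  have hmem : ∀ g ∈ S, ∃ t, rp g = some t ∧ t ∉ W ∧ u' t = true := by
    intro g hg
    rw [hS, mem_filter] at hg
    obtain ⟨_, hy, _⟩ := hg
    cases hr : rp g with
    | none => unfold yF at hy; rw [hr] at hy; exact absurd hy (by simp)
    | some t =>
      by_cases ht : t ∈ W
      · unfold yF at hy; rw [hr] at hy; simp only [ht, if_true] at hy; exact absurd hy (by simp)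
      · unfold yF at hy; rw [hr] at hy; simp only [ht, if_false, Bool.and_eq_true] at hy
        exact ⟨t, rfl, ht, hy.1⟩
  set T := univ.filter fun t : Fin n => t ∉ W ∧ u' t = true with hT
  have hmap : ∀ g ∈ S, rp g ∈ T.map Function.Embedding.some := by
    intro g hg
    obtain ⟨t, hr, ht, hu⟩ := hmem g hg
    rw [hr, mem_map]
    exact ⟨t, by rw [hT, mem_filter]; exact ⟨mem_univ _, ht, hu⟩, rfl⟩
  -- the fibre over a free `1`-position `t` is the `Crd`-set at the state of step `t`
  have hfib : ∀ t ∈ T, (S.filter fun g => rp g = some t).card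
      = Crd B rp φ b t (ctrN p u' t.val) (labN u' t.val) s := by
    intro t htT
    rw [hT, mem_filter] at htT
    obtain ⟨_, ht, hut⟩ := htT
    rw [Crd, hS, filter_filter]
    congr 1; ext g; simp only [mem_filter, mem_univ, true_and]
    constructor
    · rintro ⟨⟨hy, hl⟩, hr⟩
      have hsg := hseg g t hr ht
      refine ⟨hr, ?_, ?_⟩
      · rw [← ctrN_rdr W b hsg u hut, tabN_yB B rp φ hφ g u']
        unfold yF at hy; unfold yB; rw [hr] at hy ⊢
        simp only [ht, if_false, Bool.and_eq_true] at hy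
        exact hy.2
      · rw [← labN_rdr W b hsg u hut]; exact hl
    · rintro ⟨hr, hfl, hl⟩
      have hsg := hseg g t hr ht
      refine ⟨⟨?_, ?_⟩, hr⟩
      · unfold yF; rw [hr]; simp only [ht, if_false, Bool.and_eq_true]
        refine ⟨by rw [hu', merge_apply_free W b u ht] at hut ⊢; exact hut, ?_⟩
        rw [← ctrN_rdr W b hsg u hut, tabN_yB B rp φ hφ g u'] at hfl
        unfold yB at hfl; rw [hr] at hfl
        exact hfl
      · rw [labN_rdr W b hsg u hut]; exact hl
  rw [card_eq_sum_card_fiberwise hmap, sum_map]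
  rw [show ∑ t ∈ T, (S.filter fun g => rp g = Function.Embedding.some t).card
      = ∑ t ∈ T, Crd B rp φ b t (ctrN p u' t.val) (labN u' t.val) s from sum_congr rfl hfib]
  rw [hT, sum_filter, ← Fin.sum_univ_eq_sum_range]
  refine sum_congr rfl fun t _ => ?_
  rw [crdN, dif_pos t.isLt]

/-- **LOSE on the subcube ⟺ the E4 process ends in `L_{(n−c,0)}`.** -/
theorem lose_iff_memA (c : ℕ) (u : Fin n → Bool) :
    ringWinU c (str A B rp φ) (subcubeMerge W b u) = false ↔
      mem ((((n : ℕ) : ZMod 3) - c), none)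
        (fireA p (vfS A B rp φ W b) (XA p (vS A B rp φ W b) (subcubeMerge W b u) n)).1
        (fireA p (vfS A B rp φ W b) (XA p (vS A B rp φ W b) (subcubeMerge W b u) n)).2.1 = true := by
  set u' := subcubeMerge W b u with hu'
  set s : ZMod 3 := (((n : ℕ) : ZMod 3) - c) - labN u' n with hs
  have h1 : ringWinU c (str A B rp φ) u'
      = xor (ringWinU c (yC A B rp φ W b) u') (ringWinU c (yF B rp φ W) u') := by
    rw [← ringWinU_xor]
    exact LinForms.ringWinU_congr c fun g => str_merge A B rp φ W b g u
  have h2 : ringWinU c (yC A B rp φ W b) u' = ev (regN p (yC A B rp φ W b) u' (n + 1)) s :=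
    ringWinU_eq_ev p (yC A B rp φ W b) (fun g v w h => yC_counter A B rp φ W b hφ g v w h) c u'
  have h3 : ringWinU c (yF B rp φ W) u' = ev (cumR B rp φ W b u' n) s := by
    rw [ringWinU_eq_lab, ev_cumR, card_yF_eq_sum B rp φ W b hφ hseg u s]
  have hX1 := finalA_eq A B rp φ W b (p := p) u'
  have hX2 : (fireA p (vfS A B rp φ W b) (XA p (vS A B rp φ W b) u' n)).2.1 = labN u' n := rfl
  rw [hX1, hX2, h1, h2, h3, ← ev_bx]
  simp only [mem, patVal, ← hs]
  cases ev (bx (regN p (yC A B rp φ W b) u' (n + 1)) (cumR B rp φ W b u' n)) s <;> simp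

/-- the WIN set on the subcube as the complement of the E4 process's `L`-event. -/
theorem filter_win_eq_A (c : ℕ) :
    (univ.filter fun u : Fin n → Bool => ringWinU c (str A B rp φ) (subcubeMerge W b u) = true)
      = univ.filter fun u : Fin n → Bool =>
          mem ((((n : ℕ) : ZMod 3) - c), none)
            (fireA p (vfS A B rp φ W b) (XA p (vS A B rp φ W b) (subcubeMerge W b u) n)).1
            (fireA p (vfS A B rp φ W b) (XA p (vS A B rp φ W b) (subcubeMerge W b u) n)).2.1 = false := by
  ext u
  simp only [mem_filter, mem_univ, true_and]
  have h := lose_iff_memA A B rp φ W b hφ hseg (p := p) c u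
  constructor
  · intro hw
    cases hm : mem ((((n : ℕ) : ZMod 3) - c), none)
        (fireA p (vfS A B rp φ W b) (XA p (vS A B rp φ W b) (subcubeMerge W b u) n)).1
        (fireA p (vfS A B rp φ W b) (XA p (vS A B rp φ W b) (subcubeMerge W b u) n)).2.1
    · rfl
    · rw [h.2 hm] at hw; exact absurd hw (by simp)
  · intro hm
    cases hw : ringWinU c (str A B rp φ) (subcubeMerge W b u)
    · rw [h.1 hw] at hm; exact absurd hm (by simp)
    · rfl

/-- **near one-reads re-timed, generic** (`3 ∤ p`, `0 < p`): a one-read counter source whose free reads have frozen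
segments wins on at most `(2/3 + 5p√(12p/(n − |W| + 1)))·2ⁿ` merged inputs. -/
theorem winSubcubeNear_le (h3 : ¬ 3 ∣ p) (hp : 0 < p) (c : ℕ) :
    ((univ.filter fun u : Fin n → Bool => ringWinU c (str A B rp φ) (subcubeMerge W b u) = true).card : ℝ)
      ≤ (2 / 3 + 5 * p * Real.sqrt (12 * p / ((n - W.card : ℕ) + 1))) * (2 : ℝ) ^ n := by
  rw [filter_win_eq_A A B rp φ W b hφ hseg c]
  exact adaptiveSubcube_sharp p h3 hp (vS A B rp φ W b) (vS_mem_Adm A B rp φ W b) (vfS A B rp φ W b)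
    (vfS_mem_Adm A B rp φ W b) W b _

end Near

/-! ## §3 Prefix one-read `JLinData` on sparse subcubes -/

section Prefix

variable {p n : ℕ} (D : JLinData p n)
  (hpre : ∀ g, ∃ t : ZMod p, D.a g = fun i => if i.val < g.val then t else 0)
  (hJ1 : ∀ g, (D.J g).card ≤ 1)
include hpre hJ1

/-- **E4 on a subcube** for prefix one-read data: if every cut reading a free position has its segment frozen, at most
`(2/3 + 5p√(12p/(n − |W| + 1)))·2ⁿ` merged inputs win. -/
theorem nearReadSubcube_le (W : Finset (Fin n)) (b : Fin n → Bool) (h3 : ¬ 3 ∣ p) (hp : 0 < p)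
    (hseg : ∀ g t, readPos D g = some t → t ∉ W → ∀ i ∈ seg g t, i ∈ W) (c : ℕ) :
    ((univ.filter fun u : Fin n → Bool => ringWinU c D.strat (subcubeMerge W b u) = true).card : ℝ)
      ≤ (2 / 3 + 5 * p * Real.sqrt (12 * p / ((n - W.card : ℕ) + 1))) * (2 : ℝ) ^ n := by
  rw [strat_eq_str' D hJ1]
  exact winSubcubeNear_le _ _ _ _ W b (form_counter D hpre) hseg h3 hp c

end Prefix

end JLinPeel

end Summit.QuantumAdvantage.AdviceFreeQNC0
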